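import Mathlib
import Summits.Ventures.PercRepro2.Defs
import Summits.Ventures.PercRepro2.Graph
import Summits.Ventures.PercRepro2.OneColourSwitch
import Summits.Ventures.PercRepro2.RegionHubSign
import Summits.Ventures.PercRepro2.SideSwitch
import Summits.Ventures.PercRepro2.SideSwitchFibre
import Summits.Ventures.PercRepro2.SideSwitchClosed
import Summits.Ventures.PercRepro2.SideSwitchComps
import Summits.Ventures.PercRepro2.M9NoPocketDefs
import Summits.Ventures.PercRepro2.M9NoPocketWorld
import Summits.Ventures.PercRepro2.M9NoPocketWorldD
import Summits.Ventures.PercRepro2.M9NoPocketFibre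
import Summits.Ventures.PercRepro2.M9PocketUnitFibre
import Summits.Ventures.PercRepro2.M9PocketUnitFibreSum
import Summits.Ventures.PercRepro2.M9PocketPsi2
import Summits.Ventures.PercRepro2.M9PocketPsi2Sign


/-!
# The switchable blocks of a skeleton (blind cell PercRepro2, p3 g39, 2026-08-29;
`proofs/P3-POCKETRK.md` §10 (d): the free-block extension, part 8)

For a skeleton `ρ` (no `W`-side in `G − d`) the family of switchable blocks is the set of its
blocks (`comps` of `G − d`) with no edge to `d` and no edge from the block to the cluster of
`d` outside the block and `{r, s}`; the free edges are the edges not touching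
`U = C_Y(d) ∪ K₂(G − d) ∪ M₂(G − d)`.  This family satisfies the hypotheses of the product
fibre files (`fam_subset_K2`, `fam_notMem_r`, `fam_notMem_s`, `fam_closedIn`, `fam_free`,
`fam_pocket`, `fam_disjoint`, `mem_R_iff`), the blocks are non-empty (`fam_nonempty`), and a
`W`-side block of a `K`-only point with skeleton `ρ` belongs to the family.  Own work; std
axioms.
-/

namespace Summit.Ventures.PercRepro2

namespace NoPocket

open Finset Classical OneColourSwitch SideSwitch

variable {V : Type*} {E : Type*} [Fintype V] [DecidableEq V] {ends : E → Sym2 V}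
  {p q r s d : V} {ρ : Config E}

section Fam

variable (hdr : d ≠ r) (hds : d ≠ s) (hB : ∀ x ∈ M2 (endsD ends d) r s ρ, x = r ∨ x = s)

include hB in
/-- The sided set of a skeleton is its `Y`-world (without `r, s`). -/
lemma mem_A0_iff_of_noWside {x : V} :
    x ∈ A0 (endsD ends d) r s ρ ↔ x ∈ K2 (endsD ends d) r s ρ ∧ x ≠ r ∧ x ≠ s := by
  rw [mem_A0]
  constructor
  · rintro ⟨hU, hr, hs⟩
    refine ⟨?_, hr, hs⟩
    rcases hU with h | h
    · exact h
    · rcases hB x h with h' | h'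
      · exact (hr h').elim
      · exact (hs h').elim
  · rintro ⟨h, hr, hs⟩
    exact ⟨Or.inl h, hr, hs⟩

include hB in
/-- Every switchable block lies in the `Y`-world of `G − d`. -/
lemma fam_subset_K2 : ∀ C ∈ (comps (endsD ends d) r s ρ).filter (fun C =>
      (∀ e y, y ∈ C → ends e ≠ s(d, y)) ∧ ∀ e x y, ends e = s(x, y) → x ∈ C →
        y ∈ cluster ends ρ d → y ∈ C ∨ y = r ∨ y = s),
    (↑C : Set V) ⊆ K2 (endsD ends d) r s ρ := by
  intro C hC x hx
  have hC' := (Finset.mem_filter.1 hC).1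
  exact ((mem_A0_iff_of_noWside hB).1 (subset_A0_of_mem_comps hC' (Finset.mem_coe.1 hx))).1

/-- `r` is in no block. -/
lemma fam_notMem_r : ∀ C ∈ (comps (endsD ends d) r s ρ).filter (fun C =>
      (∀ e y, y ∈ C → ends e ≠ s(d, y)) ∧ ∀ e x y, ends e = s(x, y) → x ∈ C →
        y ∈ cluster ends ρ d → y ∈ C ∨ y = r ∨ y = s), r ∉ C := by
  intro C hC hr
  exact (mem_A0.1 (subset_A0_of_mem_comps (Finset.mem_filter.1 hC).1 hr)).2.1 rfl

/-- `s` is in no block. -/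
lemma fam_notMem_s : ∀ C ∈ (comps (endsD ends d) r s ρ).filter (fun C =>
      (∀ e y, y ∈ C → ends e ≠ s(d, y)) ∧ ∀ e x y, ends e = s(x, y) → x ∈ C →
        y ∈ cluster ends ρ d → y ∈ C ∨ y = r ∨ y = s), s ∉ C := by
  intro C hC hs
  exact (mem_A0.1 (subset_A0_of_mem_comps (Finset.mem_filter.1 hC).1 hs)).2.2 rfl

/-- Every switchable block is closed in the sided set. -/
lemma fam_closedIn : ∀ C ∈ (comps (endsD ends d) r s ρ).filter (fun C =>
      (∀ e y, y ∈ C → ends e ≠ s(d, y)) ∧ ∀ e x y, ends e = s(x, y) → x ∈ C →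
        y ∈ cluster ends ρ d → y ∈ C ∨ y = r ∨ y = s),
    ClosedIn (endsD ends d) (sided (endsD ends d) r s ρ) (↑C : Set V) :=
  fun _ hC => closedIn_of_mem_comps (Finset.mem_filter.1 hC).1

/-- Every switchable block is free. -/
lemma fam_free : ∀ C ∈ (comps (endsD ends d) r s ρ).filter (fun C =>
      (∀ e y, y ∈ C → ends e ≠ s(d, y)) ∧ ∀ e x y, ends e = s(x, y) → x ∈ C →
        y ∈ cluster ends ρ d → y ∈ C ∨ y = r ∨ y = s),
    ∀ e y, y ∈ C → ends e ≠ s(d, y) :=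
  fun _ hC => (Finset.mem_filter.1 hC).2.1

/-- Every switchable block is not attached to the cluster of `d`. -/
lemma fam_pocket : ∀ C ∈ (comps (endsD ends d) r s ρ).filter (fun C =>
      (∀ e y, y ∈ C → ends e ≠ s(d, y)) ∧ ∀ e x y, ends e = s(x, y) → x ∈ C →
        y ∈ cluster ends ρ d → y ∈ C ∨ y = r ∨ y = s),
    ∀ e x y, ends e = s(x, y) → x ∈ C → y ∈ cluster ends ρ d → y ∈ C ∨ y = r ∨ y = s :=
  fun _ hC => (Finset.mem_filter.1 hC).2.2

/-- Distinct blocks are disjoint. -/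
lemma fam_disjoint : ∀ C ∈ (comps (endsD ends d) r s ρ).filter (fun C =>
      (∀ e y, y ∈ C → ends e ≠ s(d, y)) ∧ ∀ e x y, ends e = s(x, y) → x ∈ C →
        y ∈ cluster ends ρ d → y ∈ C ∨ y = r ∨ y = s),
    ∀ C' ∈ (comps (endsD ends d) r s ρ).filter (fun C =>
      (∀ e y, y ∈ C → ends e ≠ s(d, y)) ∧ ∀ e x y, ends e = s(x, y) → x ∈ C →
        y ∈ cluster ends ρ d → y ∈ C ∨ y = r ∨ y = s), C ≠ C' → Disjoint C C' := by
  intro C hC C' hC' hne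
  rw [Finset.disjoint_left]
  intro x hx hx'
  apply hne
  rw [eq_compIn_of_mem_comps (Finset.mem_filter.1 hC).1 hx,
    eq_compIn_of_mem_comps (Finset.mem_filter.1 hC').1 hx']

/-- Every block is non-empty. -/
lemma fam_nonempty : ∀ C ∈ (comps (endsD ends d) r s ρ).filter (fun C =>
      (∀ e y, y ∈ C → ends e ≠ s(d, y)) ∧ ∀ e x y, ends e = s(x, y) → x ∈ C →
        y ∈ cluster ends ρ d → y ∈ C ∨ y = r ∨ y = s), C.Nonempty := by
  intro C hC
  obtain ⟨y, _, rfl⟩ := Finset.mem_image.1 (Finset.mem_filter.1 hC).1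
  exact ⟨y, mem_compIn_self _ y⟩

/-- A non-linking hypothesis on the free components transfers to the switchable blocks. -/
lemma fam_nl_of (hnl : ∀ C ∈ comps (endsD ends d) r s ρ, (∀ e y, y ∈ C → ends e ≠ s(d, y)) →
      (∀ e y, y ∈ C → ends e ≠ s(r, y)) ∨ (∀ e y, y ∈ C → ends e ≠ s(s, y))) :
    ∀ C ∈ (comps (endsD ends d) r s ρ).filter (fun C =>
      (∀ e y, y ∈ C → ends e ≠ s(d, y)) ∧ ∀ e x y, ends e = s(x, y) → x ∈ C →
        y ∈ cluster ends ρ d → y ∈ C ∨ y = r ∨ y = s),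
    (∀ e y, y ∈ C → ends e ≠ s(r, y)) ∨ (∀ e y, y ∈ C → ends e ≠ s(s, y)) :=
  fun C hC => hnl C (Finset.mem_filter.1 hC).1 (Finset.mem_filter.1 hC).2.1

omit [Fintype V] [DecidableEq V] in
/-- The free edges: the edges not touching `U`. -/
lemma mem_R_iff [Fintype E] [DecidableEq E] : ∀ e, e ∈ univ.filter (fun e => e ∉ touches ends
      (cluster ends ρ d ∪ K2 (endsD ends d) r s ρ ∪ M2 (endsD ends d) r s ρ)) ↔
    e ∉ touches ends (cluster ends ρ d ∪ K2 (endsD ends d) r s ρ ∪ M2 (endsD ends d) r s ρ) := by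
  intro e
  simp only [Finset.mem_filter, Finset.mem_univ, true_and]

end Fam

end NoPocket

end Summit.Ventures.PercRepro2
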